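import Literature.Combinatorics.Optimization.CardinalityCyclePolytopeEF
import Literature.Barriers.PneNP.TSPExtensionComplexityFactorization
import Literature.Combinatorics.Optimization.PsdRankBasicProperties
import Literature.Combinatorics.Optimization.LPRelaxationsMaxCSP
import HarnessLib

/-!
# Barrier: matchings (and cycles) of a single logarithmic cardinality have COMPACT non-symmetric
# extended formulations (Kaibel–Pashkovich–Theis 2012, Cor. 15 / Cor. 21) — so no LP / psd / rectangle
# lower bound can be read off one small cardinality layer — PROVED

V. Kaibel, K. Pashkovich, D. O. Theis, *Symmetry matters for sizes of extended formulations*,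
SIAM J. Discrete Math. 26 (2012) 1361–1382 = arXiv:0911.3712 [KaibelPashkovichTheis2012] (held text
`paper:arxiv-0911.3712`), abstract (p0002), verbatim: "In 1991, Yannakakis [Yan91] proved that no
symmetric extended formulation for the matching polytope of the complete graph `K_n` with `n` nodes has
a number of variables and constraints that is bounded subexponentially in `n`. […] It was also
conjectured in [Yan91] that “asymmetry does not help much,” […] In this paper we show that for the
polytopes associated with the matchings in `K_n` with `⌊log n⌋` edges there are non-symmetric extended
formulations of polynomial size, while nevertheless no symmetric extended formulations of polynomial
size exist. We furthermore prove similar statements for the polytopes associated with cycles of length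
`⌊log n⌋`."  **Corollary 15** (p0016): "For all `n` and `ℓ ≤ O(log n)`, there are compact extended
formulations for `P^ℓ_match(n)`."  **Corollary 21** (p0018): the same for `P^ℓ_cycl(n)`.

Both corollaries are THEOREMS of the tree (`CardMatchingEF.KaibelPashkovichTheis2012_cor15`:
`xc(P^ℓ_match(n)) ≤ n^{9c+3}` for `ℓ ≤ c⌊log₂ n⌋`; `CardCycleEF.KaibelPashkovichTheis2012_cor21`:
`xc(P^ℓ_cycl(n)) ≤ n^{7c+4}` for `3 ≤ ℓ ≤ c⌊log₂ n⌋`).  This file records their NO-GO content for the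
lower-bound programme on matching / TSP-type polytopes, in the currency the programme uses: by
Yannakakis' factorization theorem (EF ⇒ nonnegative factorization, the tree's
`HasEFOfSize.exists_nonneg_factorisation` [Rothvoss2017, Thm. 4]) and `rk_psd ≤ rk₊`
[FawziEtAl2015, Prop. 2.5], EVERY slack matrix built from inequalities valid on `P^ℓ_match(n)` and
points of `P^ℓ_match(n)` has nonnegative rank and psd rank `≤ n^{9c+3} + 1`, and every Rothvoß-type
hyperplane-separation functional on such a matrix certifies at most `n^{9c+3} + 1`
[Rothvoss2017, Lemma 5]; likewise for `ℓ`-cycles with `n^{7c+4} + 1`.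

* `IsCardMatchingSlack n ℓ S` / `IsCardCycleSlack n ℓ S` — the TECHNIQUE CLASS as a Lean definition:
  `S_ab = d_a − c_a·v_b` with `c_a·x ≤ d_a` valid on `P^ℓ_match(n)` (resp. `P^ℓ_cycl(n)`) and
  `v_b ∈ P^ℓ_match(n)` (resp. `P^ℓ_cycl(n)`) — the input of every slack-matrix lower-bound argument
  (rectangle covering, fooling sets, hyperplane separation, psd rank) run on ONE cardinality layer.
* `nonnegRank_ceiling_matching`, `psdRank_ceiling_matching`, `hyperplaneSeparation_ceiling_matching`
  and the `_cycle` twins — the ceilings, PROVED (no named facts).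

technique_class: single-small-cardinality slack-matrix arguments — any lower bound on extension
  complexity / nonnegative rank / psd rank / hyperplane-separation value whose input is a slack matrix
  `IsCardMatchingSlack n ℓ S` (inequalities valid for, and points of, the polytope of matchings of
  `K_n` with EXACTLY `ℓ` edges) or `IsCardCycleSlack n ℓ S` (cycles of length exactly `ℓ`), with
  `ℓ ≤ c·⌊log₂ n⌋`. [cite: KaibelPashkovichTheis2012, Cor. 15 (p0016), Cor. 21 (p0018)]
blocks: superpolynomial (in `n`) lower bounds from such data: `rk₊(S), rk_psd(S) ≤ n^{9c+3} + 1`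
  (matchings), `≤ n^{7c+4} + 1` (cycles, `ℓ ≥ 3`), and `⟨W,S⟩ ≤ (n^{9c+3}+1)·‖S‖_∞·α` for every test
  matrix `W` with rectangle sums `≤ α` (Rothvoß's Lemma 5 shape) — in particular no transfer of
  Rothvoß's `2^{Ω(n)}` [Rothvoss2017, Thm. 1] or of a psd-rank lower bound for `P_PM(K_n)` can come
  from the `⌊log n⌋`-edge layer alone. [cite: KaibelPashkovichTheis2012, abstract (p0002)]
because: colour-coding — `q = 2^{O(ℓ)} log n` colourings `[n] → [2ℓ]` hitting every `2ℓ`-set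
  bijectively (Thm. 16), one polynomial-size piece per colouring, glued by Balas' union (Lemma 17):
  `xc(P^ℓ_match(n)) ≤ 2^{O(ℓ)} n² log n` (Thm. 14), `xc(P^ℓ_cycl(n)) ≤ 2^{O(ℓ)} n³ log n` (Thm. 20, via
  the `s`–`t`-path polytope of the colour-coding digraph); then Yannakakis' factorization and
  `rk_psd ≤ rk₊`. [cite: KaibelPashkovichTheis2012, Thms. 14, 16, Lemma 17 (p0016), Thm. 20 (p0018)]
  [cite: Rothvoss2017, Thm. 4, Lemma 5 (PDF pp. 5–6)] [cite: FawziEtAl2015, Prop. 2.5 (p05)]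
evasions_known: use large cardinalities — perfect matchings (`ℓ = n/2`): `xc(P_PM(K_n)) = 2^{Ω(n)}`
  [cite: Rothvoss2017, Thm. 1 (PDF p. 3)]; or insist on SYMMETRY: no compact symmetric EF of
  `P^ℓ_match(n)` / `P^ℓ_cycl(n)` exists for `ℓ = Θ(log n)` (Yannakakis-type symmetric lower bounds)
  [cite: KaibelPashkovichTheis2012, Thm. 9 / Cor. 10 (p0011), Thm. 18 / Cor. 19 (p0017)].
scope_caveats: the printed corollaries say "compact" / `2^{O(ℓ)} n² log n` (`n³` for cycles) with
  unspecified constants; the exponents `9c+3`, `7c+4` and the `+1` (slack-form constant coordinate of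
  the tree's Yannakakis theorem) are the tree's, not printed.  The statements concern matchings of
  cardinality EXACTLY `ℓ` and cycles of length EXACTLY `ℓ ≥ 3` in the COMPLETE graph; nothing is
  claimed for `ℓ = ω(log n)`, nor for arguments that combine several layers or use perfect matchings.
  The printed theorems also bound coefficient encoding lengths, which the tree's `HasEFOfSize` does not
  record. [cite: KaibelPashkovichTheis2012, Thm. 14 / Cor. 15 (p0016), Thm. 20 / Cor. 21 (p0018)]
status: established (SIAM J. Discrete Math. 2012; both corollaries re-proved in the tree:
  `CardMatchingEF.KaibelPashkovichTheis2012_cor15`, `CardCycleEF.KaibelPashkovichTheis2012_cor21`).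

## References

* [KaibelPashkovichTheis2012] loc. cit., doi:10.1137/110839813, arXiv:0911.3712.
* [Rothvoss2017] T. Rothvoß, *The matching polytope has exponential extension complexity*, J. ACM 64
  (2017), arXiv:1311.2369 — Thm. 1, Thm. 4 (Yannakakis), Lemma 5 (hyperplane separation).
* [FawziEtAl2015] H. Fawzi, J. Gouveia, P. Parrilo, R. Robinson, R. Thomas, *Positive semidefinite
  rank*, Math. Program. 153 (2015) — Prop. 2.5 (`rank_psd ≤ rank₊`).
-/

noncomputable section

open Finset Matrix

namespace Literature.Barriers.PneNP

namespace SmallCardinalityCompactEF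

open Literature.Combinatorics.Optimization (HasNonnegFactorization HasPsdFactorization)
open Literature.Combinatorics.Optimization.CardMatchingEF (KEdge cardMatchingPolytope
  KaibelPashkovichTheis2012_cor15)
open Literature.Combinatorics.Optimization.CardCycleEF (cardCyclePolytope KaibelPashkovichTheis2012_cor21)

variable {n ℓ : ℕ} {A B : Type}

/-! ## The technique class: slack matrices of one cardinality layer -/

/-- **Technique class (matchings).** `S` is a slack matrix of the `ℓ`-cardinality matching layer of
`K_n`: `S_ab = d_a − c_a · v_b` for inequalities `c_a · x ≤ d_a` valid on `P^ℓ_match(n)` and points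
`v_b ∈ P^ℓ_match(n)`. [cite: KaibelPashkovichTheis2012, §1 (p0004) with Cor. 15 (p0016)] -/
def IsCardMatchingSlack (n ℓ : ℕ) (S : A → B → ℝ) : Prop :=
  ∃ (c : A → KEdge n → ℝ) (d : A → ℝ) (v : B → KEdge n → ℝ),
    (∀ a, ∀ x ∈ cardMatchingPolytope n ℓ, c a ⬝ᵥ x ≤ d a) ∧ (∀ b, v b ∈ cardMatchingPolytope n ℓ) ∧
      ∀ a b, S a b = d a - c a ⬝ᵥ v b

/-- **Technique class (cycles).** `S` is a slack matrix of the length-`ℓ` cycle layer of `K_n`.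
[cite: KaibelPashkovichTheis2012, §1 (p0004) with Cor. 21 (p0018)] -/
def IsCardCycleSlack (n ℓ : ℕ) (S : A → B → ℝ) : Prop :=
  ∃ (c : A → KEdge n → ℝ) (d : A → ℝ) (v : B → KEdge n → ℝ),
    (∀ a, ∀ x ∈ cardCyclePolytope n ℓ, c a ⬝ᵥ x ≤ d a) ∧ (∀ b, v b ∈ cardCyclePolytope n ℓ) ∧
      ∀ a b, S a b = d a - c a ⬝ᵥ v b

/-! ## From a compact EF to rank ceilings (Yannakakis; `rk_psd ≤ rk₊`; hyperplane separation) -/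

/-- A slack matrix of a polytope with `HasEFOfSize P r` has a nonnegative factorization of size
`r + 1` (Yannakakis, EF ⇒ factorization, re-indexed from `Option (Fin r)` to `Fin (r+1)`).
[cite: Rothvoss2017, Thm. 4 (PDF p. 5)] -/
theorem hasNonnegFactorization_of_hasEFOfSize {ι : Type} [Fintype ι] {P : Set (ι → ℝ)} {r : ℕ}
    (h : HasEFOfSize P r) (v : B → ι → ℝ) (hv : ∀ b, v b ∈ P) (c : A → ι → ℝ) (d : A → ℝ)
    (hvalid : ∀ a, ∀ x ∈ P, c a ⬝ᵥ x ≤ d a) {S : A → B → ℝ} (hS : ∀ a b, S a b = d a - c a ⬝ᵥ v b) :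
    HasNonnegFactorization S (r + 1) := by
  classical
  obtain ⟨U, T, hU, hT, hfac⟩ := h.exists_nonneg_factorisation v hv c d hvalid
  refine ⟨fun a l => U a (finSuccEquiv r l), fun l b => T (finSuccEquiv r l) b, fun a l => hU _ _,
    fun l b => hT _ _, fun a b => ?_⟩
  rw [hS, hfac a b]
  exact (Fintype.sum_equiv (finSuccEquiv r) (fun l => U a (finSuccEquiv r l) * T (finSuccEquiv r l) b)
    (fun i => U a i * T i b) fun _ => rfl).symm

/-- … hence a psd factorization of size `r + 1` (diagonal factors). [cite: FawziEtAl2015, Prop. 2.5 (p05)] -/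
theorem hasPsdFactorization_of_hasEFOfSize {ι : Type} [Fintype ι] {P : Set (ι → ℝ)} {r : ℕ}
    (h : HasEFOfSize P r) (v : B → ι → ℝ) (hv : ∀ b, v b ∈ P) (c : A → ι → ℝ) (d : A → ℝ)
    (hvalid : ∀ a, ∀ x ∈ P, c a ⬝ᵥ x ≤ d a) {S : A → B → ℝ} (hS : ∀ a b, S a b = d a - c a ⬝ᵥ v b) :
    HasPsdFactorization S (r + 1) := by
  obtain ⟨U, V, hU, hV, hM⟩ := hasNonnegFactorization_of_hasEFOfSize h v hv c d hvalid hS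
  exact HasPsdFactorization.of_nonnegFactorization U V hU hV hM

/-! ## The ceilings for the `ℓ`-matching layer, `ℓ ≤ c·⌊log₂ n⌋` -/

/-- **Nonnegative-rank ceiling**: every slack matrix of the `ℓ`-matching layer, `ℓ ≤ c⌊log₂ n⌋`, has
`rk₊ ≤ n^{9c+3} + 1`. [cite: KaibelPashkovichTheis2012, Cor. 15 (p0016)] [cite: Rothvoss2017, Thm. 4 (PDF p. 5)] -/
theorem nonnegRank_ceiling_matching (c n ℓ : ℕ) (hℓ : ℓ ≤ c * Nat.log 2 n) {S : A → B → ℝ}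
    (hS : IsCardMatchingSlack n ℓ S) : ∃ r : ℕ, r ≤ n ^ (9 * c + 3) + 1 ∧ HasNonnegFactorization S r := by
  obtain ⟨cf, d, v, hvalid, hv, hSeq⟩ := hS
  obtain ⟨r, hr, hEF⟩ := KaibelPashkovichTheis2012_cor15 c n ℓ hℓ
  exact ⟨r + 1, by omega, hasNonnegFactorization_of_hasEFOfSize hEF v hv cf d hvalid hSeq⟩

/-- **Psd-rank ceiling**: every slack matrix of the `ℓ`-matching layer, `ℓ ≤ c⌊log₂ n⌋`, has
`rk_psd ≤ n^{9c+3} + 1`. [cite: KaibelPashkovichTheis2012, Cor. 15 (p0016)] [cite: FawziEtAl2015, Prop. 2.5 (p05)] -/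
theorem psdRank_ceiling_matching (c n ℓ : ℕ) (hℓ : ℓ ≤ c * Nat.log 2 n) {S : A → B → ℝ}
    (hS : IsCardMatchingSlack n ℓ S) : ∃ r : ℕ, r ≤ n ^ (9 * c + 3) + 1 ∧ HasPsdFactorization S r := by
  obtain ⟨cf, d, v, hvalid, hv, hSeq⟩ := hS
  obtain ⟨r, hr, hEF⟩ := KaibelPashkovichTheis2012_cor15 c n ℓ hℓ
  exact ⟨r + 1, by omega, hasPsdFactorization_of_hasEFOfSize hEF v hv cf d hvalid hSeq⟩

/-- **Hyperplane-separation ceiling** (Rothvoß's Lemma 5 shape): for a slack matrix `S` of the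
`ℓ`-matching layer with entries `≤ s` and a test matrix `W` with all rectangle sums `≤ α`,
`⟨W, S⟩ ≤ (n^{9c+3} + 1)·s·α`. [cite: KaibelPashkovichTheis2012, Cor. 15 (p0016)] [cite: Rothvoss2017, Lemma 5 (PDF p. 6)] -/
theorem hyperplaneSeparation_ceiling_matching (c n ℓ : ℕ) (hℓ : ℓ ≤ c * Nat.log 2 n) [Fintype A]
    [Fintype B] [DecidableEq A] [DecidableEq B] {S : A → B → ℝ} (hS : IsCardMatchingSlack n ℓ S)
    {s : ℝ} (hs0 : 0 ≤ s) (hs : ∀ a b, S a b ≤ s) (W : A → B → ℝ) (α : ℝ)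
    (hα : ∀ (X : Finset A) (Y : Finset B), ∑ a ∈ X, ∑ b ∈ Y, W a b ≤ α) :
    ∑ a, ∑ b, W a b * S a b ≤ ((n : ℝ) ^ (9 * c + 3) + 1) * (s * α) := by
  obtain ⟨cf, d, v, hvalid, hv, hSeq⟩ := hS
  obtain ⟨r, hr, hEF⟩ := KaibelPashkovichTheis2012_cor15 c n ℓ hℓ
  have hα0 : 0 ≤ α := by simpa using hα ∅ ∅
  have h := hEF.hyperplane_separation v hv cf d hvalid hs0 (fun a b => (hSeq a b) ▸ hs a b) W α hα
  have hr' : ((r : ℝ) + 1) ≤ (n : ℝ) ^ (9 * c + 3) + 1 := by exact_mod_cast Nat.add_le_add_right hr 1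
  calc ∑ a, ∑ b, W a b * S a b = ∑ a, ∑ b, W a b * (d a - cf a ⬝ᵥ v b) := by simp only [hSeq]
    _ ≤ (r + 1) * (s * α) := h
    _ ≤ ((n : ℝ) ^ (9 * c + 3) + 1) * (s * α) := mul_le_mul_of_nonneg_right hr' (mul_nonneg hs0 hα0)

/-! ## The ceilings for the length-`ℓ` cycle layer, `3 ≤ ℓ ≤ c·⌊log₂ n⌋` -/

/-- **Nonnegative-rank ceiling (cycles)**: `rk₊ ≤ n^{7c+4} + 1`. [cite: KaibelPashkovichTheis2012, Cor. 21 (p0018)] [cite: Rothvoss2017, Thm. 4 (PDF p. 5)] -/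
theorem nonnegRank_ceiling_cycle (c n ℓ : ℕ) (h3 : 3 ≤ ℓ) (hℓ : ℓ ≤ c * Nat.log 2 n) {S : A → B → ℝ}
    (hS : IsCardCycleSlack n ℓ S) : ∃ r : ℕ, r ≤ n ^ (7 * c + 4) + 1 ∧ HasNonnegFactorization S r := by
  obtain ⟨cf, d, v, hvalid, hv, hSeq⟩ := hS
  obtain ⟨r, hr, hEF⟩ := KaibelPashkovichTheis2012_cor21 c n ℓ h3 hℓ
  exact ⟨r + 1, by omega, hasNonnegFactorization_of_hasEFOfSize hEF v hv cf d hvalid hSeq⟩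

/-- **Psd-rank ceiling (cycles)**: `rk_psd ≤ n^{7c+4} + 1`. [cite: KaibelPashkovichTheis2012, Cor. 21 (p0018)] [cite: FawziEtAl2015, Prop. 2.5 (p05)] -/
theorem psdRank_ceiling_cycle (c n ℓ : ℕ) (h3 : 3 ≤ ℓ) (hℓ : ℓ ≤ c * Nat.log 2 n) {S : A → B → ℝ}
    (hS : IsCardCycleSlack n ℓ S) : ∃ r : ℕ, r ≤ n ^ (7 * c + 4) + 1 ∧ HasPsdFactorization S r := by
  obtain ⟨cf, d, v, hvalid, hv, hSeq⟩ := hS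
  obtain ⟨r, hr, hEF⟩ := KaibelPashkovichTheis2012_cor21 c n ℓ h3 hℓ
  exact ⟨r + 1, by omega, hasPsdFactorization_of_hasEFOfSize hEF v hv cf d hvalid hSeq⟩

/-- **Hyperplane-separation ceiling (cycles)**: `⟨W, S⟩ ≤ (n^{7c+4} + 1)·s·α`.
[cite: KaibelPashkovichTheis2012, Cor. 21 (p0018)] [cite: Rothvoss2017, Lemma 5 (PDF p. 6)] -/
theorem hyperplaneSeparation_ceiling_cycle (c n ℓ : ℕ) (h3 : 3 ≤ ℓ) (hℓ : ℓ ≤ c * Nat.log 2 n)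
    [Fintype A] [Fintype B] [DecidableEq A] [DecidableEq B] {S : A → B → ℝ} (hS : IsCardCycleSlack n ℓ S)
    {s : ℝ} (hs0 : 0 ≤ s) (hs : ∀ a b, S a b ≤ s) (W : A → B → ℝ) (α : ℝ)
    (hα : ∀ (X : Finset A) (Y : Finset B), ∑ a ∈ X, ∑ b ∈ Y, W a b ≤ α) :
    ∑ a, ∑ b, W a b * S a b ≤ ((n : ℝ) ^ (7 * c + 4) + 1) * (s * α) := by
  obtain ⟨cf, d, v, hvalid, hv, hSeq⟩ := hS
  obtain ⟨r, hr, hEF⟩ := KaibelPashkovichTheis2012_cor21 c n ℓ h3 hℓ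
  have hα0 : 0 ≤ α := by simpa using hα ∅ ∅
  have h := hEF.hyperplane_separation v hv cf d hvalid hs0 (fun a b => (hSeq a b) ▸ hs a b) W α hα
  have hr' : ((r : ℝ) + 1) ≤ (n : ℝ) ^ (7 * c + 4) + 1 := by exact_mod_cast Nat.add_le_add_right hr 1
  calc ∑ a, ∑ b, W a b * S a b = ∑ a, ∑ b, W a b * (d a - cf a ⬝ᵥ v b) := by simp only [hSeq]
    _ ≤ (r + 1) * (s * α) := h
    _ ≤ ((n : ℝ) ^ (7 * c + 4) + 1) * (s * α) := mul_le_mul_of_nonneg_right hr' (mul_nonneg hs0 hα0)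

end SmallCardinalityCompactEF

end Literature.Barriers.PneNP

end
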